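import Literature.Computability.Learning.PAC
import Literature.Computability.Complexity.UniformProbBlocks
import Literature.Computability.Complexity.BlockTuples
import Literature.Computability.Complexity.StackUnaryBits
import HarnessLib

/-!
# The PAC game with uniform examples as a coin-string experiment

Counting toolkit for the analysis of reductions that SIMULATE a PAC learner on their own coins
(used by the proof of `Learning.prf_not_polyPACPredictable`, `CryptoHardnessGames.lean`): the
learning game `Learning.pacSuccessProb` of `PAC.lean` — `T` i.i.d. examples from `D`, then `c`
uniform coins, then the learner's indexed run against `pacOracle` — is, for the UNIFORM
distribution `D = U({0,1}ⁿ)`, the uniform experiment on ONE coin string of length `c + T·n` read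
as `c` learner coins followed by `T` blocks of `n` bits (`pacSuccessProb_uniform_eq_uniformProb`;
Kearns–Vazirani 1994, §1.2: "the examples are drawn independently at random", here from the
uniform distribution, so that example oracle and coins are just a longer random string —
Arora–Barak 2009, §7.1, probabilistic machines as deterministic machines reading a random tape).
Ingredients:

* `iidList_uniformOfFintype` — `T` i.i.d. uniform draws are a uniform `T`-tuple
  (`iidList (U α) T = (U (Fin T → α)).map List.ofFn`; computed through `iidList_apply_*`);
* `pointsOf n T s` — the `T` points `Fin n → Bool` read blockwise off a bit string `s`, with
  `pointsOf_ofFn_tupleEquiv` (reading a tupled family back, `Blocks.tupleEquiv`);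
* `uniformProb_window_eq` — the exact FIBRE FORMULA behind `uniformProb_block_le'`
  (`UniformProbBlocks.lean`): the probability that the window `r[a, a+ℓ)` of a uniform string of
  length `a + ℓ + d` lies in a set chosen from the coins outside the window is the average over
  the outside coins of the probabilities of these sets; corollaries `uniformProb_window_const`
  (a window event not looking outside has the probability of the window set) and
  `le_uniformProb_window` (averaging a pointwise lower bound `c₀ + c₁·[good outside]`);
* small `uniformProb` facts: `uniformProb_mono'`, `uniformProb_congr_len`,
  `uniformProb_finset_le` (a set of `K` strings has probability `≤ K / 2^ℓ`);
* `natBits_bitsToNat` (for `Complexity.natBits` of `StackUnaryBits.lean`): `bitsToNat` is injective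
  on strings of equal length (`bitsToNat_injOn_length`), `bitsToNat_eq_iff_eq_natBits`.

## References

* M. J. Kearns, U. V. Vazirani, *An Introduction to Computational Learning Theory*, MIT Press
  1994, §1.2 (the PAC game; independent examples) [KearnsVazirani1994].
* S. Arora, B. Barak, *Computational Complexity: A Modern Approach*, CUP 2009, §7.1 (random
  tapes), §A.2 (product probability spaces) [AroraBarak2009].
-/

noncomputable section

namespace Literature.Computability.Learning

open _root_.Computability Complexity Finset

open scoped Classical

/-! ### Small facts on `uniformProb` -/

/-- Monotonicity of `uniformProb` in the event (twin of `Cryptography.uniformProb_mono`, `ShorFactoring.lean`,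
and of `PromiseCook.uniformProb_mono`, both outside this file's import cone). [Arora–Barak 2009, §A.2] [folklore] -/
theorem uniformProb_mono' (m : ℕ) {E F : Set (List Bool)} (h : E ⊆ F) : uniformProb m E ≤ uniformProb m F := by
  unfold uniformProb
  refine div_le_div_of_nonneg_right ?_ (by positivity)
  exact_mod_cast card_le_card (fun r hr => by simp only [mem_filter, mem_univ, true_and] at hr ⊢; exact h hr)

/-- Events agreeing on strings of length `m` have the same probability. [folklore] -/
theorem uniformProb_congr_len (m : ℕ) {E F : Set (List Bool)} (h : ∀ r : List Bool, r.length = m → (r ∈ E ↔ r ∈ F)) :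
    uniformProb m E = uniformProb m F := by
  unfold uniformProb
  congr 2
  exact congrArg Finset.card (filter_congr fun (r : List.Vector Bool m) _ => h r.toList r.toList_length)

/-- **A set of `K` strings has probability `≤ K / 2^ℓ`.** [Arora–Barak 2009, §A.2] [folklore] -/
theorem uniformProb_finset_le (ℓ : ℕ) (s : Finset (List Bool)) : uniformProb ℓ (↑s : Set (List Bool)) ≤ s.card / 2 ^ ℓ := by
  unfold uniformProb
  refine div_le_div_of_nonneg_right ?_ (by positivity)
  have h : (univ.filter fun r : List.Vector Bool ℓ => r.toList ∈ (↑s : Set (List Bool))).card ≤ s.card := by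
    refine card_le_card_of_injOn List.Vector.toList (fun r hr => ?_) fun r _ r' _ hrr' => List.Vector.toList_injective hrr'
    simpa using hr
  exact_mod_cast h

/-- The sure event, with a predicate true on all strings of the right length. [folklore] -/
theorem uniformProb_eq_one_of_forall (m : ℕ) {E : Set (List Bool)} (h : ∀ r : List Bool, r.length = m → r ∈ E) :
    uniformProb m E = 1 := by
  rw [uniformProb_congr_len m (F := Set.univ) (fun r hr => by simp [h r hr]), uniformProb_univ]

/-! ### The fibre formula for a window of a uniform string -/

/-- **Fibre formula.** On coin strings of length `a + ℓ + d`, the probability that the window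
`(r ⇂ a) ↾ ℓ` lies in a set `B (r ↾ a) (r ⇂ (a + ℓ))` chosen from the coins outside the window is the
average, over the outside coins, of the probabilities of these sets (counting over
`{0,1}^{a+ℓ+d} ≃ {0,1}^a × {0,1}^ℓ × {0,1}^d`, `Fin.appendEquiv`). [Arora–Barak 2009, §A.2 (product spaces); §7.4.1] [folklore] -/
theorem uniformProb_window_eq {a ℓ d : ℕ} (B : List Bool → List Bool → Set (List Bool)) :
    uniformProb (a + ℓ + d) {r | (r.drop a).take ℓ ∈ B (r.take a) (r.drop (a + ℓ))} =
      (∑ uw : (Fin a → Bool) × (Fin d → Bool), uniformProb ℓ (B (List.ofFn uw.1) (List.ofFn uw.2))) / 2 ^ (a + d) := by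
  set e : ((Fin a → Bool) × (Fin ℓ → Bool)) × (Fin d → Bool) ≃ (Fin (a + ℓ + d) → Bool) :=
    (Equiv.prodCongr (Fin.appendEquiv a ℓ) (Equiv.refl _)).trans (Fin.appendEquiv (a + ℓ) d) with he
  set T : Finset (((Fin a → Bool) × (Fin ℓ → Bool)) × (Fin d → Bool)) :=
    univ.filter fun p => List.ofFn p.1.2 ∈ B (List.ofFn p.1.1) (List.ofFn p.2) with hT
  have hcard : uniformProb (a + ℓ + d) {r | (r.drop a).take ℓ ∈ B (r.take a) (r.drop (a + ℓ))} =
      (T.card : ℝ) / 2 ^ (a + ℓ + d) := by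
    rw [uniformProb_eq_card_fun]
    congr 2
    symm
    refine card_equiv e fun p => ?_
    obtain ⟨⟨u, v⟩, w⟩ := p
    have hsplit : List.ofFn (e ((u, v), w)) = (List.ofFn u ++ List.ofFn v) ++ List.ofFn w := by
      simp [he, Fin.appendEquiv, List.ofFn_fin_append]
    have hu : (List.ofFn u).length = a := List.length_ofFn
    have hv : (List.ofFn v).length = ℓ := List.length_ofFn
    have huv : (List.ofFn u ++ List.ofFn v).length = a + ℓ := by simp
    simp only [hT, mem_filter, mem_univ, true_and, Set.mem_setOf_eq, hsplit]
    rw [List.drop_left' huv, List.append_assoc, List.take_left' hu, List.drop_left' hu, List.take_left' hv]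
  -- fibrewise over (first block, last block)
  have hfib : T.card = ∑ uw : (Fin a → Bool) × (Fin d → Bool),
      (univ.filter fun v : Fin ℓ → Bool => List.ofFn v ∈ B (List.ofFn uw.1) (List.ofFn uw.2)).card := by
    rw [card_eq_sum_card_fiberwise (f := fun p : ((Fin a → Bool) × (Fin ℓ → Bool)) × (Fin d → Bool) => (p.1.1, p.2))
      (t := univ) (fun _ _ => mem_univ _)]
    refine sum_congr rfl fun uw _ => ?_
    obtain ⟨u, w⟩ := uw
    have hinj : Function.Injective (fun v : Fin ℓ → Bool => ((u, v), w)) := fun v v' h => by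
      simpa using h
    rw [← card_image_of_injective (univ.filter fun v : Fin ℓ → Bool => List.ofFn v ∈ B (List.ofFn u) (List.ofFn w)) hinj]
    congr 1
    refine Finset.ext fun p => ?_
    obtain ⟨⟨u', v⟩, w'⟩ := p
    simp only [hT, mem_filter, mem_univ, true_and, mem_image, Prod.mk.injEq]
    constructor
    · rintro ⟨h, rfl, rfl⟩; exact ⟨v, h, ⟨rfl, rfl⟩, rfl⟩
    · rintro ⟨v', h, ⟨rfl, rfl⟩, rfl⟩; exact ⟨h, rfl, rfl⟩
  have hblock : ∀ uw : (Fin a → Bool) × (Fin d → Bool),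
      ((univ.filter fun v : Fin ℓ → Bool => List.ofFn v ∈ B (List.ofFn uw.1) (List.ofFn uw.2)).card : ℝ) =
        uniformProb ℓ (B (List.ofFn uw.1) (List.ofFn uw.2)) * 2 ^ ℓ := by
    intro uw
    rw [uniformProb_eq_card_fun, div_mul_cancel₀ _ (by positivity)]
  rw [hcard, hfib]
  push_cast
  simp_rw [hblock]
  rw [← sum_mul, show (2 : ℝ) ^ (a + ℓ + d) = 2 ^ (a + d) * 2 ^ ℓ by ring, mul_div_mul_right _ _ (by positivity)]

/-- **A window event not looking outside** has the probability of the window set. [Arora–Barak 2009, §A.2] [folklore] -/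
theorem uniformProb_window_const {a ℓ d : ℕ} (B : Set (List Bool)) :
    uniformProb (a + ℓ + d) {r | (r.drop a).take ℓ ∈ B} = uniformProb ℓ B := by
  have h := uniformProb_window_eq (a := a) (ℓ := ℓ) (d := d) (fun _ _ => B)
  simp only [sum_const, card_univ, Fintype.card_prod, Fintype.card_fun, Fintype.card_bool, Fintype.card_fin,
    nsmul_eq_mul] at h
  rw [h]
  push_cast
  rw [← pow_add]
  exact mul_div_cancel_left₀ _ (by positivity)

/-- **A prefix event** has the probability of the prefix set. [Arora–Barak 2009, §A.2] [folklore] -/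
theorem uniformProb_prefix {ℓ d : ℕ} (B : Set (List Bool)) :
    uniformProb (ℓ + d) {r | r.take ℓ ∈ B} = uniformProb ℓ B := by
  have h := uniformProb_window_const (a := 0) (ℓ := ℓ) (d := d) B
  simpa using h

/-- The probability of an event of the outside coins, counted over the outside coins. [folklore] -/
theorem uniformProb_outside_eq {a ℓ d : ℕ} (good : List Bool → List Bool → Prop) :
    uniformProb (a + ℓ + d) {r | good (r.take a) (r.drop (a + ℓ))} =
      ((univ.filter fun uw : (Fin a → Bool) × (Fin d → Bool) => good (List.ofFn uw.1) (List.ofFn uw.2)).card : ℝ) /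
        2 ^ (a + d) := by
  have h := uniformProb_window_eq (a := a) (ℓ := ℓ) (d := d) (fun u w => if good u w then Set.univ else ∅)
  have hset : {r : List Bool | (r.drop a).take ℓ ∈ (if good (r.take a) (r.drop (a + ℓ)) then Set.univ else ∅ : Set (List Bool))} =
      {r | good (r.take a) (r.drop (a + ℓ))} := by
    ext r; simp only [Set.mem_setOf_eq]; split_ifs with hg <;> simp [hg]
  rw [hset] at h
  rw [h, card_eq_sum_ones, Nat.cast_sum, sum_filter]
  congr 1
  refine sum_congr rfl fun uw _ => ?_
  split_ifs <;> simp

/-- **Averaging a pointwise bound.** If every window set has probability `≥ c₀`, and `≥ c₀ + c₁` whenever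
the outside coins are `good`, then the window event has probability
`≥ c₀ + c₁ · Pr[good]`. [Arora–Barak 2009, §A.2] [folklore] -/
theorem le_uniformProb_window {a ℓ d : ℕ} (B : List Bool → List Bool → Set (List Bool))
    (good : List Bool → List Bool → Prop) {c₀ c₁ : ℝ}
    (h0 : ∀ u w : List Bool, u.length = a → w.length = d → c₀ ≤ uniformProb ℓ (B u w))
    (h1 : ∀ u w : List Bool, u.length = a → w.length = d → good u w → c₀ + c₁ ≤ uniformProb ℓ (B u w)) :
    c₀ + c₁ * uniformProb (a + ℓ + d) {r | good (r.take a) (r.drop (a + ℓ))} ≤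
      uniformProb (a + ℓ + d) {r | (r.drop a).take ℓ ∈ B (r.take a) (r.drop (a + ℓ))} := by
  rw [uniformProb_window_eq, uniformProb_outside_eq, le_div_iff₀ (by positivity), card_eq_sum_ones, Nat.cast_sum,
    sum_filter]
  have hN : ((Fintype.card ((Fin a → Bool) × (Fin d → Bool)) : ℝ)) = 2 ^ (a + d) := by
    simp [Fintype.card_prod, pow_add]
  push_cast
  have hsum : (c₀ + c₁ * ((∑ uw : (Fin a → Bool) × (Fin d → Bool),
          (if good (List.ofFn uw.1) (List.ofFn uw.2) then (1 : ℝ) else 0)) / 2 ^ (a + d))) * 2 ^ (a + d)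
      = ∑ uw : (Fin a → Bool) × (Fin d → Bool),
          (c₀ + c₁ * if good (List.ofFn uw.1) (List.ofFn uw.2) then (1 : ℝ) else 0) := by
    rw [sum_add_distrib, sum_const, card_univ, ← mul_sum, nsmul_eq_mul, hN]
    field_simp
  rw [hsum]
  refine sum_le_sum fun uw _ => ?_
  split_ifs with hg
  · simpa using h1 _ _ List.length_ofFn List.length_ofFn hg
  · simpa using h0 _ _ List.length_ofFn List.length_ofFn

/-! ### Binary numerals of prescribed length (`Complexity.natBits`, `StackUnaryBits.lean`) -/

/-- `natBits` inverts `bitsToNat` at the right length. [folklore] -/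
theorem natBits_bitsToNat : ∀ v : List Bool, natBits v.length (bitsToNat v) = v
  | [] => rfl
  | b :: v => by
    rw [List.length_cons, natBits, bitsToNat_cons]
    have h2 : (b.toNat + 2 * bitsToNat v) / 2 = bitsToNat v := by
      rw [Nat.add_mul_div_left _ _ Nat.two_pos]; cases b <;> simp
    have h1 : decide ((b.toNat + 2 * bitsToNat v) % 2 = 1) = b := by cases b <;> simp
    rw [h1, h2, natBits_bitsToNat v]

/-- **`bitsToNat` is injective on strings of equal length** (twin of
`FineGrained.BruteForce.bitsToNat_injective_of_length_eq`, `SATBruteForceCount.lean`, outside this file's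
import cone). [folklore] -/
theorem bitsToNat_injOn_length {v w : List Bool} (hl : v.length = w.length) (h : bitsToNat v = bitsToNat w) : v = w := by
  rw [← natBits_bitsToNat v, ← natBits_bitsToNat w, hl, h]

/-- A string with prescribed value: `⟦v⟧ = m ↔ v = natBits |v| m` for `m < 2^{|v|}`. [folklore] -/
theorem bitsToNat_eq_iff_eq_natBits {v : List Bool} {m : ℕ} (hm : m < 2 ^ v.length) :
    bitsToNat v = m ↔ v = natBits v.length m := by
  constructor
  · intro h; rw [← h, natBits_bitsToNat]
  · intro h; rw [h, bitsToNat_natBits (by simpa using hm)]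

/-! ### I.i.d. uniform draws are a uniform tuple -/

section IID

variable {α : Type*}

/-- `iidList D k` gives probability `0` to lists of the wrong length. [folklore] -/
theorem iidList_apply_of_length_ne (D : PMF α) : ∀ (k : ℕ) (l : List α), l.length ≠ k → iidList D k l = 0
  | 0, l, h => by
    rw [iidList_zero, PMF.pure_apply, if_neg]
    rintro rfl; exact h rfl
  | k + 1, [], _ => by
    rw [iidList, PMF.bind_apply]
    refine ENNReal.tsum_eq_zero.2 fun a => ?_
    rw [PMF.map_apply, ENNReal.tsum_eq_zero.2 fun l => by rw [if_neg (by simp)], mul_zero]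
  | k + 1, b :: t, h => by
    rw [iidList, PMF.bind_apply]
    refine ENNReal.tsum_eq_zero.2 fun a => ?_
    rw [PMF.map_apply, ENNReal.tsum_eq_zero.2 fun l => ?_, mul_zero]
    by_cases hl : b :: t = a :: l
    · rw [if_pos hl]
      obtain ⟨rfl, rfl⟩ := List.cons_eq_cons.1 hl
      exact iidList_apply_of_length_ne D k _ (by simpa using h)
    · rw [if_neg hl]

/-- **The law of `k` i.i.d. draws on a list of length `k`**: the product of the probabilities. [Kearns–Vazirani 1994, §1.2] [folklore] -/
theorem iidList_apply_of_length_eq (D : PMF α) : ∀ (k : ℕ) (l : List α), l.length = k → iidList D k l = (l.map D).prod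
  | 0, l, h => by
    obtain rfl := List.length_eq_zero_iff.1 h
    simp [iidList_zero]
  | k + 1, [], h => by simp at h
  | k + 1, b :: t, h => by
    rw [iidList, PMF.bind_apply, tsum_eq_single b]
    · rw [PMF.map_apply, tsum_eq_single t, if_pos rfl, iidList_apply_of_length_eq D k t (by simpa using h)]
      · simp
      · intro l hl
        rw [if_neg]
        intro h'; exact hl (List.cons_eq_cons.1 h').2.symm
    · intro a ha
      rw [PMF.map_apply, ENNReal.tsum_eq_zero.2 fun l => ?_, mul_zero]
      rw [if_neg]
      intro h'; exact ha (List.cons_eq_cons.1 h').1.symm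

/-- **`T` i.i.d. uniform draws are a uniform `T`-tuple**: `iidList (U α) T = (U (Fin T → α)).map ofFn`.
[Kearns–Vazirani 1994, §1.2; Arora–Barak 2009, §A.2] [folklore] -/
theorem iidList_uniformOfFintype [Fintype α] [Nonempty α] (T : ℕ) :
    iidList (PMF.uniformOfFintype α) T = (PMF.uniformOfFintype (Fin T → α)).map List.ofFn := by
  have hprod : ∀ l : List α, (l.map (PMF.uniformOfFintype α)).prod = ((Fintype.card α : ENNReal)⁻¹) ^ l.length := by
    intro l
    induction l with
    | nil => simp
    | cons a l ih => rw [List.map_cons, List.prod_cons, ih, PMF.uniformOfFintype_apply, List.length_cons, pow_succ']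
  refine PMF.ext fun l => ?_
  by_cases hl : l.length = T
  · rw [iidList_apply_of_length_eq _ T l hl, PMF.map_apply, hprod]
    subst hl
    rw [tsum_eq_single (fun i : Fin l.length => l[(i : ℕ)])]
    · rw [if_pos (List.ofFn_getElem (xs := l)).symm, PMF.uniformOfFintype_apply, Fintype.card_fun, Fintype.card_fin,
        Nat.cast_pow, ENNReal.inv_pow]
    · intro g hg
      rw [if_neg]
      intro h
      exact hg (List.ofFn_injective (h.symm.trans (List.ofFn_getElem (xs := l)).symm))
  · rw [iidList_apply_of_length_ne _ T l hl, PMF.map_apply]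
    symm
    refine ENNReal.tsum_eq_zero.2 fun g => ?_
    rw [if_neg]
    intro h
    exact hl (by rw [h, List.length_ofFn])

end IID

/-! ### Points read blockwise off a string -/

/-- The `T` points `Fin n → Bool` read blockwise off the string `s` (bit `e` of point `j` is `s[j n + e]`,
default `0`). [Arora–Barak 2009, §0.1] [folklore] -/
def pointsOf (n T : ℕ) (s : List Bool) : List (Fin n → Bool) :=
  List.ofFn fun j : Fin T => fun e : Fin n => s.getD (j * n + e) false

/-- `pointsOf n T s` has `T` points. [folklore] -/
@[simp] theorem length_pointsOf (n T : ℕ) (s : List Bool) : (pointsOf n T s).length = T := by simp [pointsOf]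

/-- **Reading a tupled family back**: the points of `ofFn (tupleEquiv T n g)` are `g`. [folklore] -/
theorem pointsOf_ofFn_tupleEquiv (n T : ℕ) (g : Fin T → Fin n → Bool) :
    pointsOf n T (List.ofFn (Blocks.tupleEquiv T n g)) = List.ofFn g := by
  unfold pointsOf
  congr 1
  funext j
  funext e
  rw [getD_ofFn _ false (blockIndex_lt e.isLt j.isLt)]
  have hidx : (⟨j * n + e, blockIndex_lt e.isLt j.isLt⟩ : Fin (T * n)) = Blocks.blkIx j e :=
    Fin.ext (by rw [Blocks.blkIx_val])
  rw [hidx, Blocks.tupleEquiv_apply_blkIx]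

/-- The points read off a string only depend on its first `T n` bits. [folklore] -/
theorem pointsOf_take (n T : ℕ) (s : List Bool) {m : ℕ} (hm : T * n ≤ m) : pointsOf n T (s.take m) = pointsOf n T s := by
  unfold pointsOf
  congr 1
  funext j
  funext e
  have hlt : (j : ℕ) * n + e < m := lt_of_lt_of_le (blockIndex_lt e.isLt j.isLt) hm
  simp [List.getD_eq_getElem?_getD, hlt]

/-- The encoding of a point read off a long enough string is the corresponding block. [folklore] -/
theorem ofFn_getD_eq_take_drop (n : ℕ) (s : List Bool) (o : ℕ) (h : o + n ≤ s.length) :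
    (List.ofFn fun e : Fin n => s.getD (o + e) false) = (s.drop o).take n := by
  apply List.ext_getElem
  · simp only [List.length_ofFn, List.length_take, List.length_drop]; omega
  · intro i h1 h2
    simp only [List.length_ofFn] at h1
    simp only [List.getElem_ofFn, List.getElem_take, List.getElem_drop, List.getD_eq_getElem?_getD,
      List.getElem?_eq_getElem (show o + i < s.length by omega), Option.getD_some]

/-! ### The PAC game with uniform examples as one coin string -/

section PACUniform

variable {n : ℕ} (dec : List Bool → ((Fin n → Bool) → Bool)) (mq : Bool) (A : OracleAlg (List Bool))
  (params : List Bool) (T c : ℕ) (f : (Fin n → Bool) → Bool) (ε : ℝ)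

/-- The success indicator of one PAC run on examples `xs` and learner coins `rc` (the integrand of
`pacSuccessProb`). [Kearns–Vazirani 1994, Def. 1] [folklore] -/
def pacSuccess (D : PMF (Fin n → Bool)) (xs : List (Fin n → Bool)) (rc : List Bool) : Bool :=
  match A.runIdx (pacOracle mq f xs) T (boolPair params rc) with
  | some w => decide (errorProb D (dec w) f ≤ ENNReal.ofReal ε)
  | none => false

/-- The coin-string event of the uniform PAC game: on `win = rc · s` (`|rc| = c`), the run with learner coins
`rc` and examples `pointsOf n T s` succeeds. [folklore] -/
def pacWindow : Set (List Bool) :=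
  {win | pacSuccess dec mq A params T f ε (PMF.uniformOfFintype _) (pointsOf n T (win.drop c)) (win.take c) = true}

/-- `pacSuccessProb` through `pacSuccess` (definitional). [folklore] -/
theorem pacSuccessProb_eq (D : PMF (Fin n → Bool)) :
    pacSuccessProb dec mq A params T c f D ε =
      ((iidList D T).bind fun xs => (PMF.uniformOfFintype (List.Vector Bool c)).map fun r =>
        pacSuccess dec mq A params T f ε D xs r.toList).toOuterMeasure {true} :=
  rfl

/-- **The uniform PAC game is a uniform coin-string experiment**: with examples from `U({0,1}ⁿ)`,
`pacSuccessProb = Pr_{win ∈ {0,1}^{c + T n}}[win ∈ pacWindow]`. [Kearns–Vazirani 1994, §1.2 with Def. 1;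
Arora–Barak 2009, §7.1] [folklore] -/
theorem pacSuccessProb_uniform_eq_uniformProb :
    (pacSuccessProb dec mq A params T c f (PMF.uniformOfFintype _) ε).toReal =
      uniformProb (c + T * n) (pacWindow dec mq A params T c f ε) := by
  -- abbreviations
  set S : (Fin T → Fin n → Bool) → List Bool → Bool :=
    fun g rc => pacSuccess dec mq A params T f ε (PMF.uniformOfFintype _) (List.ofFn g) rc with hS
  -- left-hand side: a finite average
  have hL : pacSuccessProb dec mq A params T c f (PMF.uniformOfFintype _) ε =
      ∑ g : Fin T → Fin n → Bool, ((Fintype.card (Fin T → Fin n → Bool) : ENNReal))⁻¹ *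
        (((univ.filter fun r : List.Vector Bool c => S g r.toList = true).card : ENNReal) / 2 ^ c) := by
    rw [pacSuccessProb_eq, iidList_uniformOfFintype, PMF.bind_map, PMF.toOuterMeasure_bind_apply, tsum_fintype]
    refine sum_congr rfl fun g _ => ?_
    rw [PMF.uniformOfFintype_apply, Function.comp_apply, PMF.toOuterMeasure_map_apply,
      PMF.toOuterMeasure_uniformOfFintype_apply, card_vector, Fintype.card_bool]
    congr 2
    · rw [Fintype.card_ofFinset]
      simp [hS]
    · push_cast; rfl
  -- right-hand side: count over pairs (learner coins, tuple of points)
  set e : (Fin c → Bool) × (Fin T → Fin n → Bool) ≃ (Fin (c + T * n) → Bool) :=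
    (Equiv.prodCongr (Equiv.refl _) (Blocks.tupleEquiv T n)).trans (Fin.appendEquiv c (T * n)) with he
  have hR : uniformProb (c + T * n) (pacWindow dec mq A params T c f ε) =
      ((univ.filter fun p : (Fin c → Bool) × (Fin T → Fin n → Bool) => S p.2 (List.ofFn p.1) = true).card : ℝ) /
        2 ^ (c + T * n) := by
    rw [uniformProb_eq_card_fun]
    congr 2
    symm
    refine card_equiv e fun p => ?_
    obtain ⟨u, g⟩ := p
    have hsplit : List.ofFn (e (u, g)) = List.ofFn u ++ List.ofFn (Blocks.tupleEquiv T n g) := by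
      simp [he, Fin.appendEquiv, List.ofFn_fin_append]
    have hu : (List.ofFn u).length = c := List.length_ofFn
    simp only [mem_filter, mem_univ, true_and, pacWindow, Set.mem_setOf_eq, hsplit, List.take_left' hu,
      List.drop_left' hu, pointsOf_ofFn_tupleEquiv, hS]
  have hfib : (univ.filter fun p : (Fin c → Bool) × (Fin T → Fin n → Bool) => S p.2 (List.ofFn p.1) = true).card =
      ∑ g : Fin T → Fin n → Bool, (univ.filter fun u : Fin c → Bool => S g (List.ofFn u) = true).card := by
    rw [card_eq_sum_card_fiberwise (f := Prod.snd) (t := univ) (fun _ _ => mem_univ _)]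
    refine sum_congr rfl fun g _ => ?_
    have hinj : Function.Injective (fun u : Fin c → Bool => (u, g)) := fun u u' h => by simpa using h
    rw [← card_image_of_injective (univ.filter fun u : Fin c → Bool => S g (List.ofFn u) = true) hinj]
    congr 1
    refine Finset.ext fun p => ?_
    obtain ⟨u, g'⟩ := p
    simp only [mem_filter, mem_univ, true_and, mem_image, Prod.mk.injEq]
    constructor
    · rintro ⟨h, rfl⟩; exact ⟨u, h, rfl, rfl⟩
    · rintro ⟨u', h, rfl, rfl⟩; exact ⟨h, rfl⟩
  have hvec : ∀ g : Fin T → Fin n → Bool, (univ.filter fun u : Fin c → Bool => S g (List.ofFn u) = true).card =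
      (univ.filter fun r : List.Vector Bool c => S g r.toList = true).card := by
    intro g
    symm
    refine card_equiv (Equiv.vectorEquivFin Bool c) fun r => ?_
    simp only [mem_filter, mem_univ, true_and, Equiv.vectorEquivFin, Equiv.coe_fn_mk]
    rw [← List.Vector.toList_ofFn, List.Vector.ofFn_get]
  -- compare
  rw [hL, hR, hfib, ENNReal.toReal_sum (fun g _ => ?_), Nat.cast_sum, sum_div]
  · refine sum_congr rfl fun g _ => ?_
    have key : ∀ x : ℝ, (((2 : ℝ) ^ n) ^ T)⁻¹ * (x / 2 ^ c) = x / 2 ^ (c + T * n) := fun x => by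
      rw [pow_add, mul_comm T n, pow_mul]
      field_simp
    rw [hvec, ENNReal.toReal_mul, ENNReal.toReal_inv, ENNReal.toReal_div, Fintype.card_fun, Fintype.card_fun,
      Fintype.card_fin, Fintype.card_fin, Fintype.card_bool]
    simp only [Nat.cast_pow, Nat.cast_ofNat, ENNReal.toReal_pow, ENNReal.toReal_natCast, ENNReal.toReal_ofNat]
    exact key _
  · exact ENNReal.mul_ne_top (ENNReal.inv_ne_top.2 (by simp)) (ENNReal.div_ne_top (ENNReal.natCast_ne_top _) (by simp))

end PACUniform

end Literature.Computability.Learning
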